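/- Copyright: the b2b-balaban cell (near-miss cell 7), T⁴-continuum fan-out, ROUND-2 swarm of lineage t4-ne7b-p1
(node U5c COUNT member), seat t4-ne7b-formalise-leaf-04.  Released under the licence of the surrounding project. -/
import Summits.QuantumFields.BalabanUV.T4Continuum.Support.HistoryConstantsTH
import Summits.QuantumFields.BalabanUV.T4Continuum.Support.HistorySocketTH

/-!
# History constants through the shape map, at the socket v3: the `price` fields of `LiveHistoriesTH` from print's shapes

Summits-side support leaf of the T⁴-continuum cell (rung (B)+1 on a FINITE torus only; NOT infinite volume, NOT the
mass gap, NOT the Clay statement; NOT a proof of the spine estimate NE7b).  Claim table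
`t4/b2b-balaban-t4-ne7b-p1/LEAVES-NE7b.md` sub-row S9b (ruling R-OWNER-22-8; typer's item F-S10-price-TH, S9 half), the
glue between `HistoryConstantsTH` (S9b: `Dominates` through `sh`, `HistoryConstants.shapeTH` = the TH exit's `hlabTH`
right-hand side at run `(R K, g K)`) and the landed socket v3 `HistorySocketTH` (row S7 §0: `HistorySocketTH.shapeTH`,
the `price`∕`price′` fields of `LiveHistoriesTH`).  [folklore]; nothing printed asserted; no `Prop` fact minted.

WHAT.  §1 `shapeTH_eq_socket` — the two labelled shapes are the SAME term (`rfl`; argument order and currying differ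
only).  §2 **`Dominates.price_of_pshapeTH`**: a class price below `∏_{q ∈ S} pshapeTH … (κ q) q.2` over a finite family
of live (cell, genealogy) pairs — print's credits through `sh`, realised per-step costs `κ q` READ below the model's
`costT` on the padded life (reading (ID-a)∕H3, displayed by the consumer) — is below `∏_{q ∈ S} HistorySocketTH.shapeTH
sh C Λ′ Δ R g D K q.2`, i.e. EXACTLY the right-hand side of `LiveHistoriesTH.price`∕`price′`; **`price_of_pshapeTH_slack`**
— the same with a class-linear factor `e^{θ·birthLinT sh q.2}` per member under the slack junction `C.a + θ ≤ ½γ₀A₁²`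
and profile `≥ 1` at birth steps.  §3 sanity: the glue fires on the toy pair of `HistoryConstants`.

USE (row S12).  With `H3 : F K c · Rf K c ≤ ∏_{q ∈ live K c} pshapeTH sh O C Δ Λ′ (R K) (g K) D (κ K q) q.2` displayed
and `hκ : ∀ q ∈ live K c, ∀ n ∈ life …, κ K q q.2 n ≤ costT sh C K (R K) q.2 n` displayed, the field is
`price K t ht hK c hc := hD.price_of_pshapeTH sh hΔ hΛ R g D K (live K c) (κ K) (hκ …) (H3 …)`.

HONEST.  Glue only; discharges nothing of H3 ∕ (ID-a) ∕ (B) ∕ BetaPertH.  NE7b NOT proved; spine 0∕9.  HONEST DEPENDENCY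
(cell): continuum YM on T⁴ ⇐ BetaPertH ∧ nine spine estimates (0/9 proved); BetaPertH ⇐ (D1) ∧ (D4) ∧ CAP+tail;
G-an2-4 gates asym, D1 and NE2/3/4.
-/

open Finset
open Literature.MathematicalPhysics.QuantumFieldTheory.Balaban1983to89
open T4PersistenceDictionary T4PersistentHistoryCount T4BankedInduction T4PrintedShapeBanking T4PartnerMultiplicity
open T4TaggedShapeBanking
open Summit.QuantumFields.BalabanUV.T4Continuum.LateMergers

namespace Summit.QuantumFields.BalabanUV.T4Continuum.HistoryConstants

noncomputable section

/-! ## §1 The two labelled shapes coincide -/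

section Glue

variable {ε : Type*} [DecidableEq ε] (sh : ε → PEv) (C : T4PrintedShapeBanking.Consts)

/-- **`HistoryConstants.shapeTH` at run `(R K, g K)` IS `HistorySocketTH.shapeTH`** (the same term; `rfl`). [folklore] -/
theorem shapeTH_eq_socket (Λ' Δ : ℝ) (R : ℕ → ℕ → ℕ) (g : ℕ → ℕ → ℝ) (D K : ℕ) (G : Gen ε) :
    shapeTH sh C Δ Λ' (R K) (g K) K D G = HistorySocketTH.shapeTH sh C Λ' Δ R g D K G := rfl

end Glue

/-! ## §2 The socket's `price` right-hand side from print-priced shapes -/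

section Price

variable {ε γ : Type*} [DecidableEq ε] {C : T4PrintedShapeBanking.Consts} {O : PrintedO1s} (sh : ε → PEv)

/-- **THE `price` FIELD OF `LiveHistoriesTH` FROM A DISPLAYED H3 BOUND PRICED BY PRINT'S SHAPES**: under `Dominates C O`,
a class price below the product of the members' print-priced TH shapes (realised costs read below `costT` on the padded
life) is below `∏_{q ∈ S} HistorySocketTH.shapeTH sh C Λ′ Δ R g D K q.2`. [folklore] -/
theorem Dominates.price_of_pshapeTH (hD : Dominates C O) {Λ' Δ : ℝ} (hΔ : 0 ≤ Δ) (hΛ : 0 ≤ Λ') (R : ℕ → ℕ → ℕ)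
    (g : ℕ → ℕ → ℝ) (D K : ℕ) (S : Finset (γ × Gen ε)) (κ : γ × Gen ε → Gen ε → ℕ → ℝ)
    (hκ : ∀ q ∈ S, ∀ n ∈ life (padW (dictWT sh (R K) C.n₁) D) q.2, κ q q.2 n ≤ costT sh C K (R K) q.2 n)
    {x : ℝ} (hx : x ≤ ∏ q ∈ S, pshapeTH sh O C Δ Λ' (R K) (g K) D (κ q) q.2) :
    x ≤ ∏ q ∈ S, HistorySocketTH.shapeTH sh C Λ' Δ R g D K q.2 := by
  have h := hD.le_prod_shapeTH sh hΔ hΛ (R K) (g K) K D S Prod.snd (mult := fun _ => (1 : ℝ))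
    (fun _ _ => zero_le_one) κ hκ (by simpa only [one_mul] using hx)
  simpa only [one_mul, shapeTH_eq_socket] using h

/-- **… SLACK VARIANT**: each member may carry a class-linear factor `e^{θ·birthLinT sh q.2}` (the reading's per-birth
entropy), paid by the birth-credit slack `C.a + θ ≤ ½γ₀A₁²` with profile `≥ 1` at the members' birth steps. [folklore] -/
theorem price_of_pshapeTH_slack {θ : ℝ} (hθ : 0 ≤ θ) (hslack : C.a + θ ≤ O.γ₀ * O.A₁ ^ 2 / 2) {Λ' Δ : ℝ}
    (hΔ : 0 ≤ Δ) (hΛ : 0 ≤ Λ') (R : ℕ → ℕ → ℕ) (g : ℕ → ℕ → ℝ) (D K : ℕ) (S : Finset (γ × Gen ε))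
    (κ : γ × Gen ε → Gen ε → ℕ → ℝ)
    (hP : ∀ q ∈ S, ∀ e ∈ q.2.events, (sh e).kind = 0 → 1 ≤ p0Profile C.A₀ C.p₀ (g K (sh e).step))
    (hκ : ∀ q ∈ S, ∀ n ∈ life (padW (dictWT sh (R K) C.n₁) D) q.2, κ q q.2 n ≤ costT sh C K (R K) q.2 n)
    {x : ℝ} (hx : x ≤ ∏ q ∈ S, pshapeTH sh O C Δ Λ' (R K) (g K) D (κ q) q.2 * Real.exp (θ * birthLinT sh q.2)) :
    x ≤ ∏ q ∈ S, HistorySocketTH.shapeTH sh C Λ' Δ R g D K q.2 := by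
  have h := le_prod_shapeTH_of_slack sh hθ hslack hΔ hΛ (R K) (g K) K D S Prod.snd (mult := fun _ => (1 : ℝ))
    (fun _ _ => zero_le_one) κ hP hκ (by simpa only [one_mul] using hx)
  simpa only [one_mul, shapeTH_eq_socket] using h

end Price

/-! ## §3 Sanity -/

namespace Sanity

/-- on the toy pair of `HistoryConstants`, one tagged member `(cell 4, Gt)` priced by print's shapes with the model's own
cost as realised cost lies below the socket's shape product (`Λ′ = 2`, `Δ = 1`, `R ≡ 2`, `g ≡ 1∕2`, `D = 0`, `K = 3`).
[folklore] -/
example : pshapeTH Prod.fst O₁ C₁ 1 2 (fun _ => 2) (fun _ => 1 / 2) 0 (costT Prod.fst C₁ 3 fun _ => 2) Gt ≤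
    ∏ q ∈ ({((4 : ℕ), Gt)} : Finset (ℕ × Gen (PEv × ℕ))),
      HistorySocketTH.shapeTH Prod.fst C₁ 2 1 (fun _ _ => 2) (fun _ _ => 1 / 2) 0 3 q.2 :=
  dominates_C₁_O₁.price_of_pshapeTH Prod.fst zero_le_one zero_le_two (fun _ _ => 2) (fun _ _ => 1 / 2) 0 3
    {((4 : ℕ), Gt)} (fun _ => costT Prod.fst C₁ 3 fun _ => 2) (fun _ _ _ _ => le_rfl) (by simp)

end Sanity

end

end Summit.QuantumFields.BalabanUV.T4Continuum.HistoryConstants
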